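import Literature.AnabelianGeometry.EtaleTheta.ThetaSubquotientOfTemperedAut
import Literature.AnabelianGeometry.EtaleTheta.ThetaSubquotientOfThetaSetting
import Literature.AnabelianGeometry.EtaleTheta.ThetaSubquotientLevelN
import Literature.AnabelianGeometry.EtaleTheta.Discharge.Sec5ThetaSubquotientProjCriterion

/-!
# [EtTh] §5 p.327: `ThetaSubquotientProj 𝔉` is EMPTY at the R2 carrier as soon as the base has a RIGID covering with non-trivial `(l·Δ_Θ)_E`

S. Mochizuki, *The étale theta function and its Frobenioid-theoretic manifestations*, Publ. RIMS **45** (2009), §5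
p. 327 (PDF p. 101) [cite: MochizukiEtTh2009, §5 p.327 (PDF p.101)]: "for `D ∈ Ob(D)`, these subquotients
[`Π^tp_X ↠ (Π^tp_X)^Θ ⊇ l·Δ_Θ`] determine subquotients `Aut_D(D) ↠ Aut^Θ_D(D)`; `(l·Δ_Θ)_D ⊆ Aut^Θ_D(D)`".
abc-iut cell, layer L2, seat abc-iut-L2-t9 (gen 5; unit W2-L2-05 lineage — the R2 instance `thetaSubquotientStub`).
PROOF-ONLY (0 `def`, no instance, no notation, no `Prop`-valued fact); nothing landed is edited or restated.

WHY.  abc-iut-L2-t4's record `FrobenioidCyclotomicRigidity.ThetaSubquotientProj 𝔉` (frozen, `FrobenioidCyclotomicRigidity.lean`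
l.97–103) asks, for EVERY object `E` of the base `D`, for a subgroup `pre E ≤ Aut_D(E)` SURJECTING onto `𝔉.lDelta E`.  It is the binder
`(P : ThetaSubquotientProj 𝔉)` of the whole Prop. 5.5 / Thm. 5.6 chain (`IsKummerDetermined`, `Thm56SubdagProofs`, the K4 end knits
`Discharge/Sec5Thm56EndKnitLevelN*`, the print's-`Q` kit p445332/p447951); no `P`-TERM exists at the genuine data (GAP-LEDGER
G-w4d042g3-1; VNEXT census item B1, plan (a) "weaken to onto-at-Galois").  abc-iut-w5-d029's
`Discharge/Sec5ThetaSubquotientProjCriterion.lean` reduced inhabitation to "every `(l·Δ_Θ)_E` is a homomorphic image of a subgroup of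
`Aut_D(E)`" and recorded the shape `isEmpty_of_rigid_of_nontrivial` (ONE rigid object with non-trivial carrier empties the record), putting
to "the owners (abc-iut-L2-t4 §5 / abc-iut-L2-t9 `thetaSubquotientStub`)" the question whether such an object exists at the R2 carrier.
This file makes that question GROUP-THEORETIC and answers it in the form the genuine data can be checked against.

WHAT IS PROVED (over any topological group `Π`, any `q : Π →* Q`, `ι : Λ →* Q` with normal image — the parameters of the R2 instance).
* `mem_normalizer_stabilizer_of_aut` / `aut_eq_one_of_normalizer_le` / **`subsingleton_aut_of_normalizer_le`** — a connected object
  `E` of `B^temp(Π)` (ANY index) with a point `x` whose stabiliser `H = Stab(x)` is SELF-NORMALISING (`N_Π(H) ≤ H`) is RIGID: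
  `Aut(E)` is trivial (an automorphism moves `x` to `g·x` with `g⁻¹Hg ≤ H`, its inverse gives `gHg⁻¹ ≤ H`, so `g ∈ N_Π(H) = H`);
  `subsingleton_aut_connectedPart_of_normalizer_le` — the same in `B^temp(Π)⁰` (the inclusion is faithful).
* `nontrivial_carrier_of_kill_ne_top` / `subsingleton_carrier_of_kill_eq_top` / **`nontrivial_lDelta_iff_kill_ne_top`** — by this
  lineage's `evalEquiv : (l·Δ_Θ)_E ≃* Λ/ι⁻¹J(Stab x)`, the R2 carrier at a connected `E` is non-trivial IFF
  `J(Stab x) := ι⁻¹((q(Stab x) ⊓ L) ⊔ ⁅L, q(Stab x)⁆) ≠ ⊤` (`ThetaSubquotient.kill`).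
* **`isEmpty_thetaSubquotientProj_of_stub_eq_of_rigid`** — for EVERY §5 datum `𝔉 : ThetaFrobenioid C (B^temp(Π)⁰)` with
  `𝔉.toThetaSubquotientStub = thetaSubquotientStub q ι`, one connected `E`, point `x`, with `N_Π(Stab x) ≤ Stab x` and `J(Stab x) ≠ ⊤`
  gives `IsEmpty (ThetaSubquotientProj 𝔉)`; **`isEmpty_thetaSubquotientProj_of_stub_eq_of_normalizer_le`** — subgroup form: an OPEN
  `H ≤ Π` of countable index with `N_Π(H) ≤ H` and `J(H) ≠ ⊤` (the object `Π/H` is built inside the proof; no definition);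
  `kill_eq_top_of_thetaSubquotientProj` — conversely, under any `P` every self-normalising open stabiliser has `J = ⊤`.
* The two pinned data of record: **`isEmpty_thetaSubquotientProj_ofSettingSub_of_normalizer_le`** — print's `Q` at abc-iut-L2-t1's
  setting (`ofSettingSub D l U = thetaSubquotientStub (qSub D U) (ιTheta D l)`, rfl `ofSettingSub_eq`; abc-iut-L2-t4's junction object
  `ofThetaSettingDataQ` has this stub by its rfl lemma `ofThetaSettingDataQ_toThetaSubquotientStub`), and
  **`RigidData.isEmpty_thetaSubquotientProj_levelStub_of_normalizer_le`** — abc-iut-w4-d042's level-`N` stub `RD.levelStub ιX`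
  (= `thetaSubquotientStub (RD.qN ιX) RD.iotaN`, rfl; the carrier of the K4 end knits p442234/p444342/p447610/p448631 by
  `ofConnectedTemperoidData_levelN_stub`).

READING (numbers, not adjectives).  (1) At a GALOIS object the R2 carrier IS print's subquotient of `Aut_D(E) = Π/N` and `autProj` is
onto (p427537/p429126/p438430): no conflict there.  (2) At a RIGID object print's subquotient of `Aut_D(E) = 1` is trivial while the R2
carrier is the coinvariant receptacle `Λ/J(H)`; the record's `∀ E` clause then fails exactly when `J(H) ≠ ⊤`.  (3) Which `Π` have such
`H`?  KERNEL, separate file of this row: abc-iut-L2-t1's root model `ThetaSetting.model p` (`Π^tp_X = F₂ × G_{ℚ_p}`), `H := ⟨a⟩ × G_{ℚ_p}`.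
MATHEMATICS, not kernel (stated for the planners, asserting nothing in the tree): for the tempered fundamental group of a once-punctured
elliptic curve over an MLF one expects such `H` as well — inside the open subgroup `ker(χ mod 2)` (so that `⁅L, q H⁆ ≤ 2L`, `L ≅ Ẑ`),
deep in the `Δ_Θ`-direction (so that `q H ⊓ L ≤ 2L`), self-normalising via a wreath-type finite quotient of an open subgroup of the
free profinite `Δ̂_X`; an `H` CONTAINING `Ker(Π ↠ Q/2L)` can never work (the central involution of `Q/2L` normalises it), which is why
no finite-level "Galois-like" object detects the phenomenon.  CONSEQUENCE for the (C2) list: wherever such an `H` exists, every theorem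
binding `(P : ThetaSubquotientProj 𝔉)` at `thetaSubquotientStub`/`levelStub`/`ofSettingSub` quantifies over an EMPTY type (vacuous as
instantiated, nothing false), so VNEXT B1 plan (a)/(B) (relativise `proj_surjective` to Galois objects / index `P` by `B_N^bs` alone)
is load-bearing for a non-vacuous Prop. 5.5 / Thm. 5.6 at genuine data, not cosmetic.

HONEST FRAMING: pure group theory about this lineage's carrier and abc-iut-L2-t4's record; nothing is asserted about [EtTh]'s curves
(the expectation in (3) is prose, labelled as such); [EtTh] is a refereed paper; no side is taken on [IUTchIII] Cor. 3.12; typed ≠ proved.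
-/

namespace Literature.AnabelianGeometry.EtaleTheta

namespace ThetaSubquotient

open CategoryTheory Literature.AlgebraicGeometry.Frobenioids Literature.AnabelianGeometry.SemiGraphs
open Literature.AlgebraicGeometry.Frobenioids.QuasiTemperoid (stabilizerSubgroup mem_stabilizerSubgroup_iff)
open Literature.AlgebraicGeometry.Frobenioids.QuasiTemperoid.BTempConnected (hom_ρ ρ_mul_apply
  ρ_one_apply ρ_inv_apply exists_ρ_eq_of_isConnectedObj hom_eq_of_apply_eq isConnectedObj_of_transitive)
open FrobenioidCyclotomicRigidity (ThetaSubquotientProj)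

-- `l·Δ_Θ ⊆ (Π^tp_X)^Θ` at the setting is a `CommGroup` through Mathlib's scoped `IsMulCommutative` instance
-- (the device of `ThetaSubquotientOfThetaSetting.lean`).
open scoped IsMulCommutative

universe u v w u₁ v₁

variable {G : Type u} [Group G] [TopologicalSpace G]

/-! ### 1. Rigid connected objects of `B^temp(Π)`: self-normalising stabiliser ⇒ `Aut` trivial -/

section Rigid

/-- An element `g ∈ Π` carrying a point `x` of a CONNECTED object `E` of `B^temp(Π)` to its image `σ(x)` under an
automorphism `σ` NORMALISES the stabiliser `Stab(x)`: equivariance of `σ` gives `g⁻¹·Stab(x)·g ≤ Stab(x)`, equivariance of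
`σ⁻¹` (carrying `x` to some `g'·x` with `g g' ∈ Stab(x)`) gives the reverse inclusion.  (`Aut_D(Π/H) = N_Π(H)/H`, the half
needed here, for objects of ANY index.) [cite: MochizukiEtTh2009, §5 p.327 (PDF p.101)] -/
theorem mem_normalizer_stabilizer_of_aut (E : BTemp G) (hE : IsConnectedObj E) (x : E.obj.V) (σ : Aut E)
    {g : G} (hg : E.obj.ρ g x = σ.hom.hom.hom x) :
    g ∈ Subgroup.normalizer (stabilizerSubgroup E x : Set G) := by
  obtain ⟨g', hg'⟩ := exists_ρ_eq_of_isConnectedObj E hE x (σ⁻¹.hom.hom.hom x)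
  -- `g⁻¹ h g ∈ Stab(x)` for `h ∈ Stab(x)` (as `Stab(x) ≤ Stab(σ x) = Stab(g·x)`), and likewise for `σ⁻¹`, `g'`
  have h1 : ∀ h ∈ stabilizerSubgroup E x, g⁻¹ * h * g ∈ stabilizerSubgroup E x := by
    intro h hh
    rw [mem_stabilizerSubgroup_iff] at hh ⊢
    rw [ρ_mul_apply, ρ_mul_apply, hg, ← hom_ρ, hh, ← hg, ρ_inv_apply]
  have h1' : ∀ h ∈ stabilizerSubgroup E x, g'⁻¹ * h * g' ∈ stabilizerSubgroup E x := by
    intro h hh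
    rw [mem_stabilizerSubgroup_iff] at hh ⊢
    rw [ρ_mul_apply, ρ_mul_apply, hg', ← hom_ρ, hh, ← hg', ρ_inv_apply]
  -- `g g' ∈ Stab(x)` since `σ⁻¹ (σ x) = x`
  have h2 : g * g' ∈ stabilizerSubgroup E x := by
    rw [mem_stabilizerSubgroup_iff, ρ_mul_apply, hg', ← hom_ρ, hg, aut_inv_apply_apply]
  refine Subgroup.mem_normalizer_iff.2 fun h => ⟨fun hh => ?_, fun hh => ?_⟩
  · have e : g * h * g⁻¹ = (g * g') * (g'⁻¹ * h * g') * (g * g')⁻¹ := by group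
    rw [e]
    exact (stabilizerSubgroup E x).mul_mem ((stabilizerSubgroup E x).mul_mem h2 (h1' h hh))
      ((stabilizerSubgroup E x).inv_mem h2)
  · have e : h = g⁻¹ * (g * h * g⁻¹) * g := by group
    rw [e]
    exact h1 _ hh

/-- **Rigidity**: if the stabiliser of a point of a connected object `E` of `B^temp(Π)` is SELF-NORMALISING
(`N_Π(Stab x) ≤ Stab x`), every automorphism of `E` is the identity. [cite: MochizukiEtTh2009, §5 p.327 (PDF p.101)] -/
theorem aut_eq_one_of_normalizer_le (E : BTemp G) (hE : IsConnectedObj E) (x : E.obj.V)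
    (hN : Subgroup.normalizer (stabilizerSubgroup E x : Set G) ≤ stabilizerSubgroup E x) (σ : Aut E) :
    σ = 1 := by
  obtain ⟨g, hg⟩ := exists_ρ_eq_of_isConnectedObj E hE x (σ.hom.hom.hom x)
  have hgx : E.obj.ρ g x = x := mem_stabilizerSubgroup_iff.1 (hN (mem_normalizer_stabilizer_of_aut E hE x σ hg))
  have hσ : σ.hom = 𝟙 E := hom_eq_of_apply_eq hE σ.hom (𝟙 E) x (by rw [← hg, hgx]; rfl)
  exact Iso.ext hσ

/-- **Rigid objects**: `Aut(E)` is trivial for a connected `E ∈ Ob(B^temp(Π))` with self-normalising point-stabiliser.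
[cite: MochizukiEtTh2009, §5 p.327 (PDF p.101)] -/
theorem subsingleton_aut_of_normalizer_le (E : BTemp G) (hE : IsConnectedObj E) (x : E.obj.V)
    (hN : Subgroup.normalizer (stabilizerSubgroup E x : Set G) ≤ stabilizerSubgroup E x) :
    Subsingleton (Aut E) :=
  ⟨fun σ τ => (aut_eq_one_of_normalizer_le E hE x hN σ).trans (aut_eq_one_of_normalizer_le E hE x hN τ).symm⟩

/-- The same in the connected part `B^temp(Π)⁰` (the base category `D` of the §5 data; its inclusion into `B^temp(Π)` is
faithful). [cite: MochizukiEtTh2009, §5 p.327 (PDF p.101)] -/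
theorem subsingleton_aut_connectedPart_of_normalizer_le (E : ConnectedPart (BTemp G)) (x : E.obj.obj.V)
    (hN : Subgroup.normalizer (stabilizerSubgroup E.obj x : Set G) ≤ stabilizerSubgroup E.obj x) :
    Subsingleton (Aut E) := by
  refine ⟨fun σ τ => Iso.ext (ObjectProperty.hom_ext _ ?_)⟩
  have h : (connectedObjects (BTemp G)).ι.mapIso σ = (connectedObjects (BTemp G)).ι.mapIso τ :=
    @Subsingleton.elim (Aut E.obj) (subsingleton_aut_of_normalizer_le E.obj E.property x hN) _ _
  exact congrArg Iso.hom h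

end Rigid

/-! ### 2. The R2 carrier at a connected object is non-trivial iff `J(Stab x) ≠ ⊤` -/

section Carrier

variable {Q : Type v} [Group Q] {Λ : Type w} [CommGroup Λ] (q : G →* Q) (ι : Λ →* Q)

omit [TopologicalSpace G] in
/-- `Λ/J(S)` is non-trivial when `J(S) ≠ Λ`. [cite: MochizukiEtTh2009, §5 p.327 (PDF p.101)] -/
theorem nontrivial_carrier_of_kill_ne_top {S : Subgroup G} (h : kill q ι S ≠ ⊤) :
    Nontrivial (Carrier q ι S) := by
  obtain ⟨a, -, ha⟩ := SetLike.exists_of_lt (lt_top_iff_ne_top.2 h)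
  exact ⟨⟨(a : Carrier q ι S), 1, by rwa [Ne, QuotientGroup.eq_one_iff]⟩⟩

omit [TopologicalSpace G] in
/-- `Λ/J(S)` is trivial when `J(S) = Λ`. [cite: MochizukiEtTh2009, §5 p.327 (PDF p.101)] -/
theorem subsingleton_carrier_of_kill_eq_top {S : Subgroup G} (h : kill q ι S = ⊤) :
    Subsingleton (Carrier q ι S) := by
  refine ⟨fun a b => ?_⟩
  induction a using QuotientGroup.induction_on with
  | H a =>
    induction b using QuotientGroup.induction_on with
    | H b =>
      rw [QuotientGroup.eq, h]
      exact Subgroup.mem_top _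

variable [ι.range.Normal]

/-- The R2 carrier `(l·Δ_Θ)_E` of a connected object is non-trivial when `J(Stab x) ≠ ⊤` (transport along this lineage's
`evalEquiv : (l·Δ_Θ)_E ≃* Λ/J(Stab x)`). [cite: MochizukiEtTh2009, §5 p.327 (PDF p.101)] -/
theorem nontrivial_lDelta_of_kill_ne_top {E : BTemp G} (hE : IsConnectedObj E) (x : E.obj.V)
    (h : kill q ι (stabilizerSubgroup E x) ≠ ⊤) : Nontrivial (LDelta q ι E) :=
  haveI := nontrivial_carrier_of_kill_ne_top q ι h
  (evalEquiv q ι hE x).toEquiv.nontrivial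

/-- **Exact criterion**: the R2 carrier `(l·Δ_Θ)_E` of a connected object `E` is non-trivial IFF `J(Stab x) ≠ ⊤`, for any
point `x`. [cite: MochizukiEtTh2009, §5 p.327 (PDF p.101)] -/
theorem nontrivial_lDelta_iff_kill_ne_top {E : BTemp G} (hE : IsConnectedObj E) (x : E.obj.V) :
    Nontrivial (LDelta q ι E) ↔ kill q ι (stabilizerSubgroup E x) ≠ ⊤ := by
  refine ⟨fun hn hk => ?_, fun h => nontrivial_lDelta_of_kill_ne_top q ι hE x h⟩
  haveI := subsingleton_carrier_of_kill_eq_top q ι hk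
  haveI : Subsingleton (LDelta q ι E) := (evalEquiv q ι hE x).toEquiv.subsingleton
  exact false_of_nontrivial_of_subsingleton (LDelta q ι E)

end Carrier

/-! ### 3. `ThetaSubquotientProj 𝔉` is EMPTY over a base with a rigid object of non-trivial carrier -/

section Main

variable {Q : Type v} [Group Q] {Λ : Type w} [CommGroup Λ] (q : G →* Q) (ι : Λ →* Q) [ι.range.Normal]
  {C : Type u₁} [Category.{v₁} C] (𝔉 : ThetaFrobenioid.{max u w} C (ConnectedPart (BTemp G)))

/-- **EMPTINESS, object form.**  For a §5 datum `𝔉` over `B^temp(Π)⁰` whose theta-subquotient stub is this lineage's R2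
instance `thetaSubquotientStub q ι`: ONE connected object `E` with a point `x` such that `N_Π(Stab x) ≤ Stab x` (rigid) and
`J(Stab x) ≠ ⊤` (non-trivial carrier) makes `ThetaSubquotientProj 𝔉` EMPTY — by abc-iut-w5-d029's
`isEmpty_of_rigid_of_nontrivial`.  Every theorem binding `(P : ThetaSubquotientProj 𝔉)` is then vacuous for this `𝔉`.
[cite: MochizukiEtTh2009, §5 p.327 (PDF p.101)] -/
theorem isEmpty_thetaSubquotientProj_of_stub_eq_of_rigid
    (h𝔉 : 𝔉.toThetaSubquotientStub = thetaSubquotientStub q ι)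
    (E : ConnectedPart (BTemp G)) (x : E.obj.obj.V)
    (hN : Subgroup.normalizer (stabilizerSubgroup E.obj x : Set G) ≤ stabilizerSubgroup E.obj x)
    (hk : kill q ι (stabilizerSubgroup E.obj x) ≠ ⊤) :
    IsEmpty (ThetaSubquotientProj 𝔉) := by
  haveI := subsingleton_aut_connectedPart_of_normalizer_le E x hN
  haveI : Nontrivial (𝔉.lDelta E) := by
    have e : 𝔉.lDelta E = LDelta q ι E.obj :=
      congrArg (fun s : FrobenioidTheta.ThetaSubquotientStub.{max u w} (ConnectedPart (BTemp G)) => s.lDelta E) h𝔉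
    rw [e]
    exact nontrivial_lDelta_of_kill_ne_top q ι E.property x hk
  exact FrobenioidCyclotomicRigidity.ThetaSubquotientProj.isEmpty_of_rigid_of_nontrivial E

/-- **EMPTINESS, subgroup form.**  For `Π` a topological group and `𝔉` as above: an OPEN subgroup `H ≤ Π` of countable index
that is SELF-NORMALISING (`N_Π(H) ≤ H`) with `J(H) = ι⁻¹((q H ⊓ L) ⊔ ⁅L, q H⁆) ≠ ⊤` makes `ThetaSubquotientProj 𝔉` empty (the
connected object `Π/H` with base point `1·H`, stabiliser `H`, is assembled inside the proof).
[cite: MochizukiEtTh2009, §5 p.327 (PDF p.101)] -/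
theorem isEmpty_thetaSubquotientProj_of_stub_eq_of_normalizer_le [IsTopologicalGroup G]
    (h𝔉 : 𝔉.toThetaSubquotientStub = thetaSubquotientStub q ι)
    (H : Subgroup G) (hHo : IsOpen (H : Set G)) (hHc : Countable (G ⧸ H))
    (hN : Subgroup.normalizer (H : Set G) ≤ H) (hk : kill q ι H ≠ ⊤) :
    IsEmpty (ThetaSubquotientProj 𝔉) := by
  -- the stabilisers of the left cosets are the conjugates of `H`, open
  have hopen : ∀ y : G ⧸ H, IsOpen {g : G | (Action.ofMulAction G (G ⧸ H)).ρ g y = y} := by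
    intro y
    induction y using QuotientGroup.induction_on with
    | H a =>
      have hc : Continuous fun g : G => a⁻¹ * g * a := (continuous_const.mul continuous_id).mul continuous_const
      convert hHo.preimage hc using 1
      ext g
      simp only [Set.mem_setOf_eq, Set.mem_preimage, SetLike.mem_coe]
      change g • (a : G ⧸ H) = (a : G ⧸ H) ↔ _
      rw [MulAction.Quotient.smul_coe, smul_eq_mul, QuotientGroup.eq,
        show (g * a)⁻¹ * a = (a⁻¹ * g * a)⁻¹ by group, inv_mem_iff]
  let E₀ : BTemp G := ⟨Action.ofMulAction G (G ⧸ H), hHc, hopen⟩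
  have htr : ∀ r : E₀.obj.V, ∃ g : G, E₀.obj.ρ g ((1 : G) : G ⧸ H) = r := fun r =>
    QuotientGroup.induction_on r fun a => ⟨a, by
      change a • ((1 : G) : G ⧸ H) = (a : G ⧸ H)
      rw [MulAction.Quotient.smul_coe, smul_eq_mul, mul_one]⟩
  have hE₀ : IsConnectedObj E₀ := isConnectedObj_of_transitive E₀ ((1 : G) : G ⧸ H) htr
  have hS : stabilizerSubgroup E₀ ((1 : G) : G ⧸ H) = H := by
    ext g
    rw [mem_stabilizerSubgroup_iff]
    change g • ((1 : G) : G ⧸ H) = ((1 : G) : G ⧸ H) ↔ _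
    rw [MulAction.Quotient.smul_coe, smul_eq_mul, mul_one, QuotientGroup.eq, mul_one, inv_mem_iff]
  exact isEmpty_thetaSubquotientProj_of_stub_eq_of_rigid q ι 𝔉 h𝔉 ⟨E₀, hE₀⟩ ((1 : G) : G ⧸ H)
    (show Subgroup.normalizer (stabilizerSubgroup E₀ ((1 : G) : G ⧸ H) : Set G) ≤
        stabilizerSubgroup E₀ ((1 : G) : G ⧸ H) by rw [hS]; exact hN)
    (show kill q ι (stabilizerSubgroup E₀ ((1 : G) : G ⧸ H)) ≠ ⊤ by rw [hS]; exact hk)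

/-- **Converse bookkeeping**: under any `P : ThetaSubquotientProj 𝔉` at the R2 stub, every connected object with self-normalising
point-stabiliser has TRIVIAL carrier, i.e. `J(Stab x) = ⊤` — the exact obstruction the record imposes on the base.
[cite: MochizukiEtTh2009, §5 p.327 (PDF p.101)] -/
theorem kill_eq_top_of_thetaSubquotientProj (h𝔉 : 𝔉.toThetaSubquotientStub = thetaSubquotientStub q ι)
    (P : ThetaSubquotientProj 𝔉) (E : ConnectedPart (BTemp G)) (x : E.obj.obj.V)
    (hN : Subgroup.normalizer (stabilizerSubgroup E.obj x : Set G) ≤ stabilizerSubgroup E.obj x) :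
    kill q ι (stabilizerSubgroup E.obj x) = ⊤ := by
  by_contra hk
  exact (isEmpty_thetaSubquotientProj_of_stub_eq_of_rigid q ι 𝔉 h𝔉 E x hN hk).false P

end Main

/-! ### 4. The two pinned data of record: print's `Q` at the setting, and the level-`N` stub -/

section Setting

variable {p : ℕ} [Fact p.Prime] (D : ThetaSetting p) (l : ℕ) (U : Subgroup D.PiTemp)
  {C : Type u₁} [Category.{v₁} C]

/-- **Print's `Q` (`ofSettingSub D l U`, the stub of abc-iut-L2-t4's junction object `ofThetaSettingDataQ`)**: over
`B^temp(U)⁰`, `U ≤ Π^tp_X`, a self-normalising open `H ≤ U` of countable index with `J(H) ≠ ⊤` for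
`(q, ι) = ((Π^tp_X ↠ (Π^tp_X)^Θ)|_U, l·Δ_Θ ↪ (Π^tp_X)^Θ)` makes `ThetaSubquotientProj 𝔉` EMPTY for every §5 datum `𝔉` with that stub.
[cite: MochizukiEtTh2009, §5 p.327 (PDF p.101)] -/
theorem isEmpty_thetaSubquotientProj_ofSettingSub_of_normalizer_le
    (𝔉 : ThetaFrobenioid.{0} C (ConnectedPart (BTemp ↥U)))
    (h𝔉 : 𝔉.toThetaSubquotientStub = ofSettingSub D l U)
    (H : Subgroup ↥U) (hHo : IsOpen (H : Set ↥U)) (hHc : Countable (↥U ⧸ H))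
    (hN : Subgroup.normalizer (H : Set ↥U) ≤ H) (hk : kill (qSub D U) (ιTheta D l) H ≠ ⊤) :
    IsEmpty (ThetaSubquotientProj 𝔉) :=
  isEmpty_thetaSubquotientProj_of_stub_eq_of_normalizer_le (qSub D U) (ιTheta D l) 𝔉
    (h𝔉.trans (ofSettingSub_eq D l U)) H hHo hHc hN hk

/-- Object form at print's `Q`. [cite: MochizukiEtTh2009, §5 p.327 (PDF p.101)] -/
theorem isEmpty_thetaSubquotientProj_ofSettingSub_of_rigid
    (𝔉 : ThetaFrobenioid.{0} C (ConnectedPart (BTemp ↥U)))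
    (h𝔉 : 𝔉.toThetaSubquotientStub = ofSettingSub D l U)
    (E : ConnectedPart (BTemp ↥U)) (x : E.obj.obj.V)
    (hN : Subgroup.normalizer (stabilizerSubgroup E.obj x : Set ↥U) ≤ stabilizerSubgroup E.obj x)
    (hk : kill (qSub D U) (ιTheta D l) (stabilizerSubgroup E.obj x) ≠ ⊤) :
    IsEmpty (ThetaSubquotientProj 𝔉) :=
  isEmpty_thetaSubquotientProj_of_stub_eq_of_rigid (qSub D U) (ιTheta D l) 𝔉
    (h𝔉.trans (ofSettingSub_eq D l U)) E x hN hk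

/-- **Single underline case "`A = X`"** (`ofSetting D l`, over `B^temp(Π^tp_X)⁰` itself): a self-normalising open
`H ≤ Π^tp_X` of countable index with `J(H) ≠ ⊤` for `(q, ι) = (Π^tp_X ↠ (Π^tp_X)^Θ, l·Δ_Θ ↪ (Π^tp_X)^Θ)` makes
`ThetaSubquotientProj 𝔉` EMPTY for every §5 datum with that stub. [cite: MochizukiEtTh2009, §5 p.322 (PDF p.96)] -/
theorem isEmpty_thetaSubquotientProj_ofSetting_of_normalizer_le
    (𝔉 : ThetaFrobenioid.{0} C (ConnectedPart (BTemp D.PiTemp)))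
    (h𝔉 : 𝔉.toThetaSubquotientStub = ofSetting D l)
    (H : Subgroup D.PiTemp) (hHo : IsOpen (H : Set D.PiTemp)) (hHc : Countable (D.PiTemp ⧸ H))
    (hN : Subgroup.normalizer (H : Set D.PiTemp) ≤ H) (hk : kill D.toTheta (ιTheta D l) H ≠ ⊤) :
    IsEmpty (ThetaSubquotientProj 𝔉) :=
  isEmpty_thetaSubquotientProj_of_stub_eq_of_normalizer_le D.toTheta (ιTheta D l) 𝔉
    (h𝔉.trans (ofSetting_eq D l)) H hHo hHc hN hk

end Setting

end ThetaSubquotient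

namespace RigidData

open CategoryTheory Literature.AlgebraicGeometry.Frobenioids Literature.AnabelianGeometry.SemiGraphs
open Literature.AlgebraicGeometry.Frobenioids.QuasiTemperoid (stabilizerSubgroup)
open FrobenioidCyclotomicRigidity (ThetaSubquotientProj)

universe u v u₁ v₁

variable {N : ℕ+} {l : ℕ} (RD : RigidData.{u} N l) {G : Type v} [Group G] [TopologicalSpace G]
  (ιX : RD.PiX ≃ₜ* G) {C : Type u₁} [Category.{v₁} C]

/-- **Level `N` (`RD.levelStub ιX`, the carrier of the K4 end knits)**: a self-normalising open `H ≤ Π` of countable index with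
`J_N(H) := ι_N⁻¹((q_N H ⊓ ι_N(μ_N)) ⊔ ⁅ι_N(μ_N), q_N H⁆) ≠ ⊤` makes `ThetaSubquotientProj 𝔉` EMPTY for every §5 datum `𝔉` over
`B^temp(Π)⁰` with `𝔉.toThetaSubquotientStub = RD.levelStub ιX`. [cite: MochizukiEtTh2009, §5 p.327 (PDF p.101)] -/
theorem isEmpty_thetaSubquotientProj_levelStub_of_normalizer_le [IsTopologicalGroup G]
    (𝔉 : ThetaFrobenioid.{max v u} C (ConnectedPart (BTemp G)))
    (h𝔉 : 𝔉.toThetaSubquotientStub = RD.levelStub ιX)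
    (H : Subgroup G) (hHo : IsOpen (H : Set G)) (hHc : Countable (G ⧸ H))
    (hN : Subgroup.normalizer (H : Set G) ≤ H)
    (hk : ThetaSubquotient.kill (RD.qN ιX) RD.iotaN H ≠ ⊤) :
    IsEmpty (ThetaSubquotientProj 𝔉) :=
  haveI := RD.iotaN_range_normal
  ThetaSubquotient.isEmpty_thetaSubquotientProj_of_stub_eq_of_normalizer_le (RD.qN ιX) RD.iotaN 𝔉
    (h𝔉.trans (rfl : RD.levelStub ιX = ThetaSubquotient.thetaSubquotientStub (RD.qN ιX) RD.iotaN)) H hHo hHc hN hk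

/-- Object form at level `N`. [cite: MochizukiEtTh2009, §5 p.327 (PDF p.101)] -/
theorem isEmpty_thetaSubquotientProj_levelStub_of_rigid
    (𝔉 : ThetaFrobenioid.{max v u} C (ConnectedPart (BTemp G)))
    (h𝔉 : 𝔉.toThetaSubquotientStub = RD.levelStub ιX)
    (E : ConnectedPart (BTemp G)) (x : E.obj.obj.V)
    (hN : Subgroup.normalizer (stabilizerSubgroup E.obj x : Set G) ≤ stabilizerSubgroup E.obj x)
    (hk : ThetaSubquotient.kill (RD.qN ιX) RD.iotaN (stabilizerSubgroup E.obj x) ≠ ⊤) :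
    IsEmpty (ThetaSubquotientProj 𝔉) :=
  haveI := RD.iotaN_range_normal
  ThetaSubquotient.isEmpty_thetaSubquotientProj_of_stub_eq_of_rigid (RD.qN ιX) RD.iotaN 𝔉
    (h𝔉.trans (rfl : RD.levelStub ιX = ThetaSubquotient.thetaSubquotientStub (RD.qN ιX) RD.iotaN)) E x hN hk

end RigidData

end Literature.AnabelianGeometry.EtaleTheta
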